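import Literature.Computability.QuantumComplexity.ZXCalculusHopf
import HarnessLib

/-!
# `ZX_{π/4}` modulo the calculus: the Clifford scalar lemmas of JPV (Lemmas 2, 5, 6, 7 (Clifford angles), 8) and the π/2 states

Topic `Literature/Computability/QuantumComplexity`, continuing `ZXCalculusHopf.lean`: layers A9–A12 of the formalisation of
`JeandelPerdrixVilmart2018_completeness` (Jeandel–Perdrix–Vilmart, LICS 2018, Thm 1), merged into one module. Four parts, each
with its own header below: (A9) `2 = √2·√2`, the Hopf law on three wires, the inverse rule (IV) = JPV Lemmas 2, 5;
(A10) cancelling scalars, `H ∘ H = 𝕀` (JPV Lemma 8), multiplying global phases (JPV Lemma 6); (A11) the (H)/(EU) rules on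
states, the `±π/2` states of both colours; (A12) JPV Lemma 7 (a green–red dumbbell with a zero angle is `√2`) at the
Clifford angles. All statements are equalities in the quotient `ZXClass` (`ZXCalculusQuotient.lean`), i.e. derivations in
`ZX_{π/4}`; nothing is assumed. [cite: JeandelPerdrixVilmart2018, Appendix Lemmas 2, 5, 6, 7, 8]
-/

/-! ## Part: `ZXCalculusInverse.lean` -/
/-!
# `ZX_{π/4}` modulo the calculus: `2 = √2·√2`, the Hopf law on three wires, the inverse rule

Topic `Literature/Computability/QuantumComplexity`, continuing `ZXCalculusHopf.lean` (layer A9 of the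
formalisation of `JeandelPerdrixVilmart2018_completeness`): three more of the Clifford scalar
lemmas of JPV's appendix, derived inside the term calculus from Figure 1.

* **JPV Lemma 2** (`two_eq_sqrt_two_sq`): the green scalar dot `Z^{(0,0)}(0)` (value `2`) is
  `√2 ⊗ √2`; derivation: (B1) closed by a cap, fusion, and the colourlessness of `√2`.
* the Hopf law between a red `X^{(1,3)}` and a green `Z^{(3,0)}` joined by three wires
  (`hopf_three`): two of the three wires disconnect (`hopf`), the third fuses away.
* **JPV Lemma 5 = the inverse rule (IV)** (`inverse_rule`): `√2 ⊗ (Z^{(0,3)} ⨾ X^{(3,0)})` is the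
  empty diagram — `Z^{(0,3)} ⨾ X^{(3,0)}` is the tree's `invSqrtTwo`. Derivation of
  Jeandel–Perdrix–Vilmart–Wang (MFCS 2017, Prop. "(IV) is derivable from ZX_E"): introduce the
  scalar `X^{(0,1)}(-π/4) ⨾ Z^{(1,0)}(π/4) = 1` by (E), un-fuse, merge the two red states with (B1)
  (which produces the second `√2`), apply the Hopf law on three wires, fuse, and remove the scalar
  by (E) again; stated in both colourings (`inverse_rule_red`, `inverse_rule`).

## References

* E. Jeandel, S. Perdrix, R. Vilmart, LICS 2018 (arXiv:1705.11151v2), Appendix Lemmas 2, 3, 5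
  [JeandelPerdrixVilmart2018].
* E. Jeandel, S. Perdrix, R. Vilmart, Q. Wang, *ZX-calculus: cyclotomic supplementarity and
  incompleteness for Clifford+T quantum mechanics*, MFCS 2017 (arXiv:1702.01945), §3, Prop.
  "(IV) is derivable from ZX_E" (the derivation followed here).
* M. Backens, S. Perdrix, Q. Wang, QPL 2016 (arXiv:1602.04744), Lemma `starroot2` (2 = √2·√2).
-/

noncomputable section

namespace Literature.Computability.QuantumComplexity

open ZXDiagram ZXClass

namespace ZXClass

/-! ### `2 = √2 · √2` -/

/-- (B1) closed by a cap: `√2 ⊗ (X^{(0,1)} ⨾ Z^{(1,0)}) = X^{(0,1)} ⨾ X^{(1,0)}`, i.e.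
`√2 ⊗ √2 = X^{(0,0)}(0)`. [cite: JeandelPerdrixVilmart2018, Appendix Lemma 2] -/
theorem sqrt_two_sq_eq_X : mk (dumbbell 0 0) ⊠ mk (dumbbell 0 0) = mk (X 0 0 0) := by
  have hZ : mk (Z 1 0 0) = mk (Z 1 2 0) ⨟ mk cap := by
    rw [← Z_two_zero, Z_seq_Z 1 2 0 (by norm_num), add_zero (0 : ZMod 8)]
  conv_lhs => arg 2; rw [dumbbell, mk_seq, hZ, ← seq_assoc]
  rw [scalar_par_seq_left, rule_B1, empty_par, cast_id, par_eq_seq_right (mk (X 0 1 0)) (mk (X 0 1 0)),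
    empty_par, cast_id, seq_assoc, xstate_par_seq_cap, X_seq_X 0 1 0 le_rfl, add_zero (0 : ZMod 8)]

/-- **JPV Lemma 2**: the green scalar dot is `√2 ⊗ √2`: `Z^{(0,0)}(0) = √2 ⊗ √2`.
[cite: JeandelPerdrixVilmart2018, Appendix Lemma 2] -/
theorem two_eq_sqrt_two_sq : mk (Z 0 0 0) = mk (dumbbell 0 0) ⊠ mk (dumbbell 0 0) := by
  have h := congrArg colorSwap sqrt_two_sq_eq_X
  simp only [colorSwap_par, colorSwap_mk, mk_colorSwap_dumbbell_zero, colorSwap_X] at h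
  exact h.symm

/-- The red scalar dot is `√2 ⊗ √2` as well. [cite: JeandelPerdrixVilmart2018, Appendix Lemma 2] -/
theorem xtwo_eq_sqrt_two_sq : mk (X 0 0 0) = mk (dumbbell 0 0) ⊠ mk (dumbbell 0 0) :=
  sqrt_two_sq_eq_X.symm

/-! ### The Hopf law on three wires -/

/-- A scalar slides inside a by-passing wire (arities `1 → 1`). [folklore] -/
theorem scalar_par_wires_par_one (s : ZXClass 0 0) (A : ZXClass 1 1) :
    s ⊠ (mk (wires 1) ⊠ A) = mk (wires 1) ⊠ (s ⊠ A) := by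
  rw [par_assoc', cast_id, scalar_par_wires]
  exact (par_assoc _ _ _).trans (cast_id _ _ _)

/-- A scalar in the middle of a three-fold composite. [folklore] -/
theorem scalar_par_seq_seq {n m k l : ℕ} (s : ZXClass 0 0) (A : ZXClass n m) (B : ZXClass m k)
    (C : ZXClass k l) : s ⊠ (A ⨟ B ⨟ C) = (mk (wires 0) ⊠ A) ⨟ (s ⊠ B) ⨟ (mk (wires 0) ⊠ C) := by
  rw [scalar_par_seq_left, scalar_par_seq_right]

/-- **The Hopf law on three wires**: `√2 ⊗ √2 ⊗ (X^{(1,3)} ⨾ Z^{(3,0)}) = Z^{(1,0)}` — two of the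
three wires disconnect by the Hopf law, the remaining one fuses. [cite: JeandelPerdrixVilmart2018, Appendix Lemma 3] -/
theorem hopf_three :
    mk (dumbbell 0 0) ⊠ (mk (dumbbell 0 0) ⊠ (mk (X 1 3 0) ⨟ mk (Z 3 0 0))) = mk (Z 1 0 0) := by
  have hX : mk (X 1 3 0) = mk (X 1 2 0) ⨟ (mk (wires 1) ⊠ mk (X 1 2 0)) := by
    rw [X_seq_par_X 1 1 1 2 le_rfl, add_zero (0 : ZMod 8)]
  have hZ : mk (Z 3 0 0) = (mk (wires 1) ⊠ mk (Z 2 1 0)) ⨟ mk (Z 2 0 0) := by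
    rw [par_Z_seq_Z 1 2 1 0 le_rfl, add_zero (0 : ZMod 8)]
  have hmid : mk (X 1 3 0) ⨟ mk (Z 3 0 0) =
      mk (X 1 2 0) ⨟ (mk (wires 1) ⊠ (mk (X 1 2 0) ⨟ mk (Z 2 1 0))) ⨟ mk (Z 2 0 0) := by
    rw [hX, hZ, wires_par_seq]
    simp only [seq_assoc]
  rw [hmid, scalar_par_seq_seq, empty_par, cast_id, empty_par, cast_id, scalar_par_seq_seq,
    empty_par, cast_id, empty_par, cast_id, scalar_par_wires_par_one, scalar_par_wires_par_one,
    hopf, wires_par_seq, ← seq_assoc, X_seq_par_X 1 1 1 0 le_rfl, add_zero (0 : ZMod 8), seq_assoc,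
    par_Z_seq_Z 1 0 1 0 le_rfl, add_zero (0 : ZMod 8), X_one_one, id_seq]

/-! ### The inverse rule -/

/-- (E) upside down: `X^{(0,1)}(-π/4) ⨾ Z^{(1,0)}(π/4)` is the empty diagram. [cite: JeandelPerdrixVilmart2018, Fig. 1 (E)] -/
theorem rule_E' : mk (X 0 1 (-1)) ⨟ mk (Z 1 0 1) = mk (wires 0) := by
  simpa using (Rule.transpose Rule.e_rule).eq

/-- **The inverse rule (IV), red above green** (JPV Lemma 5 colour-swapped; MFCS 2017):
`√2 ⊗ (X^{(0,3)}(0) ⨾ Z^{(3,0)}(0))` is the empty diagram. [cite: JeandelPerdrixVilmart2018, Appendix Lemma 5] -/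
theorem inverse_rule_red : mk (dumbbell 0 0) ⊠ (mk (X 0 3 0) ⨟ mk (Z 3 0 0)) = mk (wires 0) := by
  -- un-fusions used below
  have hX3 : mk (X 0 3 0) = mk (X 0 1 0) ⨟ mk (X 1 3 0) := by
    rw [X_seq_X 0 1 3 le_rfl, add_zero (0 : ZMod 8)]
  have hXm : mk (X 0 1 (-1)) = mk (X 0 1 0) ⨟ mk (X 1 1 (-1)) := by
    rw [X_seq_X 0 1 1 le_rfl, zero_add (-1 : ZMod 8)]
  -- (1) introduce the unit scalar of (E) next to the diagram and interchange
  have step1 : mk (X 0 3 0) ⨟ mk (Z 3 0 0) =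
      (mk (X 0 1 0) ⊠ mk (X 0 1 0)) ⨟ ((mk (X 1 3 0) ⊠ mk (X 1 1 (-1))) ⨟
        (mk (Z 3 0 0) ⊠ mk (Z 1 0 1))) := by
    conv_lhs => rw [← par_empty (mk (X 0 3 0) ⨟ mk (Z 3 0 0)), ← rule_E', ← interchange, hX3, hXm,
      ← interchange, seq_assoc]
  -- (2) (B1) backwards merges the two red states, producing a second `√2`
  have step2 : mk (X 0 1 0) ⊠ mk (X 0 1 0) = mk (dumbbell 0 0) ⊠ (mk (X 0 1 0) ⨟ mk (Z 1 2 0)) :=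
    rule_B1.symm
  -- (3) both `√2` act on the three-wire pair: Hopf
  have step3 : mk (dumbbell 0 0) ⊠ (mk (dumbbell 0 0) ⊠ ((mk (X 1 3 0) ⊠ mk (X 1 1 (-1))) ⨟
      (mk (Z 3 0 0) ⊠ mk (Z 1 0 1)))) = mk (Z 1 0 0) ⊠ (mk (X 1 1 (-1)) ⨟ mk (Z 1 0 1)) := by
    rw [interchange, par_assoc', cast_id, par_assoc', cast_id, ← hopf_three]
    congr 1
    exact (par_assoc _ _ _).trans (cast_id _ _ _)
  have step3' : (mk (dumbbell 0 0) ⊠ mk (dumbbell 0 0)) ⊠ ((mk (X 1 3 0) ⊠ mk (X 1 1 (-1))) ⨟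
      (mk (Z 3 0 0) ⊠ mk (Z 1 0 1))) = mk (Z 1 0 0) ⊠ (mk (X 1 1 (-1)) ⨟ mk (Z 1 0 1)) :=
    ((par_assoc _ _ _).trans (cast_id _ _ _)).trans step3
  -- assemble: both `√2` travel to the three-wire pair
  rw [step1, step2, scalar_par_seq_right, empty_par, cast_id,
    interchange (mk (dumbbell 0 0)) (mk (dumbbell 0 0)) (mk (X 0 1 0) ⨟ mk (Z 1 2 0)),
    ← scalar_par_eq_seq, scalar_par_seq_right (mk (dumbbell 0 0) ⊠ mk (dumbbell 0 0)), empty_par,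
    cast_id, step3', par_eq_seq_left (mk (Z 1 0 0)), empty_par, cast_id, seq_assoc,
    ← seq_assoc (mk (Z 1 2 0)), Z_seq_Z_par 1 1 1 0 le_rfl, add_zero (0 : ZMod 8), Z_one_one, id_seq,
    ← seq_assoc, ← hXm, rule_E']

/-- **The inverse rule (IV)** (JPV Lemma 5): `√2 ⊗ (Z^{(0,3)}(0) ⨾ X^{(3,0)}(0))` — `√2` times the
tree's diagram `invSqrtTwo` for `1/√2` — is the empty diagram. [cite: JeandelPerdrixVilmart2018, Appendix Lemma 5] -/
theorem inverse_rule : mk (dumbbell 0 0) ⊠ mk invSqrtTwo = mk (wires 0) := by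
  have h := congrArg colorSwap inverse_rule_red
  simp only [colorSwap_par, colorSwap_seq, colorSwap_mk, mk_colorSwap_dumbbell_zero, colorSwap_X,
    colorSwap_Z, colorSwap_wires] at h
  simpa [invSqrtTwo] using h

/-- `√2 ⊗ (1/√2) = 1` with the factors exchanged. [cite: JeandelPerdrixVilmart2018, Appendix Lemma 5] -/
theorem invSqrtTwo_par_dumbbell : mk invSqrtTwo ⊠ mk (dumbbell 0 0) = mk (wires 0) := by
  rw [scalar_par_comm, inverse_rule]

end ZXClass

end Literature.Computability.QuantumComplexity


/-! ## Part: `ZXCalculusScalars.lean` -/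
/-!
# `ZX_{π/4}` modulo the calculus: cancelling scalars, `H ∘ H = 𝕀`, multiplying global phases

Topic `Literature/Computability/QuantumComplexity`, continuing `ZXCalculusInverse.lean` (layer A10
of the formalisation of `JeandelPerdrixVilmart2018_completeness`).

* JPV's scalars `dumbbell a b = X^{(0,1)}(a) ⨾ Z^{(1,0)}(b)` in general: drawn on a cup
  (`dumbbell_eq_cup`), equal to `Z^{(0,1)}(b) ⨾ X^{(1,0)}(a)` (`dumbbell_symm`), hence invariant
  under the flip and exchanged by the colour swap (`mk_transpose_dumbbell`, `mk_colorSwap_dumbbell`);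
* **cancellation**: thanks to the inverse rule, `√2` cancels (`cancel_sqrt_two`), so does the
  circle `η ⨾ ε = Z^{(0,0)}(0) = 2` (`cup_seq_cap`, `cancel_two`), and therefore a by-passing WIRE
  cancels between scalars: `s ⊗ 𝕀 = t ⊗ 𝕀 → s = t` (`cancel_wire`, by closing the wire into a
  circle);
* **JPV Lemma 8**: `H ⨾ H = 𝕀` (`hBox_seq_hBox`) — immediate from rule (H) at arity `1 → 1` and (S2);
* **JPV Lemma 6** (multiplying global phases): `(Z^{(0,1)}(π) ⨾ X^{(1,0)}(α)) ⊗ (Z^{(0,1)}(π) ⨾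
  X^{(1,0)}(β)) = (Z^{(0,1)}(π) ⨾ X^{(1,0)}(α+β)) ⊗ √2` (`multiplying_global_phases`). Derivation
  (ours, shorter than the cited one in this axiomatisation): evaluate
  `√2 ⊗ √2 ⊗ (X(α) ⨾ X(β) ⨾ Z(π))` with rule (K) either at once (after fusing the red phases) or in
  two steps, cancel the invertible `1 → 1` remainder and the by-passing wire.

## References

* E. Jeandel, S. Perdrix, R. Vilmart, LICS 2018 (arXiv:1705.11151v2), Appendix Lemmas 6, 8 and
  rule (K) [JeandelPerdrixVilmart2018].
* M. Backens, S. Perdrix, Q. Wang, QPL 2016 (arXiv:1602.04744), App. A (the cited source of Lemma 6).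
-/

noncomputable section

namespace Literature.Computability.QuantumComplexity

open ZXDiagram ZXClass

namespace ZXClass

/-! ### General dumbbells -/

/-- `X^{(0,1)}(a) ⨾ Z^{(1,0)}(b)` drawn on a cup: `η ⨾ (Z^{(1,0)}(b) ⊗ X^{(1,0)}(a))`. [cite: JeandelPerdrixVilmart2018, §2.2] -/
theorem dumbbell_eq_cup (a b : ZMod 8) :
    mk (dumbbell a b) = mk cup ⨟ (mk (Z 1 0 b) ⊠ mk (X 1 0 a)) := by
  rw [dumbbell, mk_seq, ← cup_seq_par_xeffect, seq_assoc]
  congr 1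
  calc mk (wires 1) ⊠ mk (X 1 0 a) ⨟ mk (Z 1 0 b)
        = (mk (wires 1) ⊠ mk (X 1 0 a)) ⨟ (mk (Z 1 0 b) ⊠ mk (wires 0)) := by rw [par_empty]
    _ = mk (Z 1 0 b) ⊠ mk (X 1 0 a) := by rw [interchange, id_seq, seq_id]

/-- **Dumbbells are symmetric**: `X^{(0,1)}(a) ⨾ Z^{(1,0)}(b) = Z^{(0,1)}(b) ⨾ X^{(1,0)}(a)`. [folklore] -/
theorem dumbbell_symm (a b : ZMod 8) : mk (dumbbell a b) = mk (Z 0 1 b) ⨟ mk (X 1 0 a) := by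
  rw [dumbbell_eq_cup, cup_seq_par_comm, ← cup_seq_par_effect b, seq_assoc]
  congr 1
  calc mk (X 1 0 a) ⊠ mk (Z 1 0 b) = (mk (wires 1) ⨟ mk (X 1 0 a)) ⊠ (mk (Z 1 0 b) ⨟ mk (wires 0)) := by
          rw [id_seq, seq_id]
    _ = mk (wires 1) ⊠ mk (Z 1 0 b) ⨟ mk (X 1 0 a) := by rw [← interchange, par_empty]

/-- The flip of a dumbbell is the same dumbbell. [folklore] -/
@[simp] theorem mk_transpose_dumbbell (a b : ZMod 8) : mk (dumbbell a b).transpose = mk (dumbbell a b) := by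
  conv_rhs => rw [dumbbell_symm]
  simp [dumbbell]

/-- The colour swap exchanges the two phases of a dumbbell. [folklore] -/
@[simp] theorem mk_colorSwap_dumbbell (a b : ZMod 8) : mk (dumbbell a b).colorSwap = mk (dumbbell b a) := by
  rw [dumbbell_symm b a]
  simp [dumbbell]

/-! ### Cancelling scalars -/

/-- A scalar absorbs into / re-associates with a `1 → 1` map on its right. [folklore] -/
theorem scalar_par_seq_one (s : ZXClass 0 0) (A B : ZXClass 1 1) : (s ⊠ A) ⨟ B = s ⊠ (A ⨟ B) := by
  rw [scalar_par_seq_left, empty_par, cast_id]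

/-- A `1 → 1` map followed by a scalar-carrying one. [folklore] -/
theorem seq_scalar_par_one (s : ZXClass 0 0) (A B : ZXClass 1 1) : A ⨟ (s ⊠ B) = s ⊠ (A ⨟ B) := by
  rw [scalar_par_seq_right, empty_par, cast_id]

/-- **`√2` cancels** (by the inverse rule). [cite: JeandelPerdrixVilmart2018, Appendix Lemma 5] -/
theorem cancel_sqrt_two {s t : ZXClass 0 0} (h : s ⊠ mk (dumbbell 0 0) = t ⊠ mk (dumbbell 0 0)) :
    s = t := by
  have h' : (s ⊠ mk (dumbbell 0 0)) ⊠ mk invSqrtTwo = (t ⊠ mk (dumbbell 0 0)) ⊠ mk invSqrtTwo :=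
    congrArg (· ⊠ mk invSqrtTwo) h
  rwa [par_assoc, cast_id, par_assoc, cast_id, inverse_rule, par_empty, par_empty] at h'

/-- The circle is the green scalar dot: `η ⨾ ε = Z^{(0,0)}(0)`. [cite: JeandelPerdrixVilmart2018, §2.2] -/
theorem cup_seq_cap : mk cup ⨟ mk cap = mk (Z 0 0 0) := by
  rw [← Z_zero_two, ← Z_two_zero, Z_seq_Z 0 2 0 (by norm_num), add_zero]

/-- **`2` cancels**: the green scalar dot cancels. [cite: JeandelPerdrixVilmart2018, Appendix Lemma 2] -/
theorem cancel_two {s t : ZXClass 0 0} (h : s ⊠ mk (Z 0 0 0) = t ⊠ mk (Z 0 0 0)) : s = t := by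
  rw [two_eq_sqrt_two_sq, par_assoc', cast_id, par_assoc', cast_id] at h
  exact cancel_sqrt_two (cancel_sqrt_two h)

/-- Closing a scalar-carrying wire into a circle. [folklore] -/
theorem cup_seq_scalar_par_wires_seq_cap (s : ZXClass 0 0) :
    mk cup ⨟ ((s ⊠ mk (wires 1)) ⊠ mk (wires 1)) ⨟ mk cap = s ⊠ mk (Z 0 0 0) := by
  rw [← cup_seq_cap, scalar_par_seq_right, empty_par, cast_id, par_eq_seq_left s (mk cap), empty_par,
    cast_id, seq_assoc]
  congr 2
  rw [← wires_par_wires 1 1]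
  exact (par_assoc _ _ _).trans (cast_id _ _ _)

/-- **A by-passing wire cancels between scalars**: `s ⊗ 𝕀 = t ⊗ 𝕀 → s = t`. [folklore] -/
theorem cancel_wire {s t : ZXClass 0 0} (h : s ⊠ mk (wires 1) = t ⊠ mk (wires 1)) : s = t := by
  have h' := congrArg (fun A => mk cup ⨟ (A ⊠ mk (wires 1)) ⨟ mk cap) h
  simp only [cup_seq_scalar_par_wires_seq_cap] at h'
  exact cancel_two h'

/-! ### `H ∘ H = 𝕀` -/

/-- **JPV Lemma 8**: the Hadamard box is an involution, `H ⨾ H = 𝕀` (rule (H) at arity `1 → 1`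
with (S2)). [cite: JeandelPerdrixVilmart2018, Appendix Lemma 8] -/
@[simp] theorem hBox_seq_hBox : mk hBox ⨟ mk hBox = mk (wires 1) := by
  have h := rule_H 1 1 0
  simp only [hTensor, mk_par, X_one_one, seq_id, Z_one_one] at h
  rwa [empty_par, cast_id] at h

/-! ### Multiplying global phases -/

/-- Rule (K) with a `1 → 1` map attached below, scalars kept outside. [cite: JeandelPerdrixVilmart2018, Fig. 1 (K)] -/
theorem rule_K_seq (a : ZMod 8) (A : ZXClass 1 1) :
    mk (dumbbell 0 0) ⊠ (mk (X 1 1 a) ⨟ mk (Z 1 1 4) ⨟ A) =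
      mk (dumbbell a 4) ⊠ (mk (Z 1 1 4) ⨟ mk (X 1 1 (-a)) ⨟ A) := by
  rw [← scalar_par_seq_one, rule_K, scalar_par_seq_one]

/-- The `1 → 1` remainder of rule (K) is invertible: `(Z(π) ⨾ X(-c)) ⨾ (X(c) ⨾ Z(π)) = 𝕀`. [folklore] -/
theorem K_remainder_inv (c : ZMod 8) :
    (mk (Z 1 1 4) ⨟ mk (X 1 1 (-c))) ⨟ (mk (X 1 1 c) ⨟ mk (Z 1 1 4)) = mk (wires 1) := by
  rw [seq_assoc, ← seq_assoc (mk (X 1 1 (-c))), xphase_seq_xphase, neg_add_cancel, X_one_one, id_seq,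
    phase_seq_phase, show (4 : ZMod 8) + 4 = 0 from by decide, Z_one_one]

/-- **JPV Lemma 6, (K)-form**: `√2 ⊗ (X^{(0,1)}(a+b) ⨾ Z^{(1,0)}(π)) =
(X^{(0,1)}(b) ⨾ Z^{(1,0)}(π)) ⊗ (X^{(0,1)}(a) ⨾ Z^{(1,0)}(π))`. [cite: JeandelPerdrixVilmart2018, Appendix Lemma 6] -/
theorem sqrt_two_par_dumbbell_add (a b : ZMod 8) :
    mk (dumbbell 0 0) ⊠ mk (dumbbell (a + b) 4) = mk (dumbbell b 4) ⊠ mk (dumbbell a 4) := by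
  -- `T := √2 ⊗ √2 ⊗ (X(a) ⨾ X(b) ⨾ Z(π) ⨾ W⁻¹)` evaluated in two ways, `W⁻¹ = X(a+b) ⨾ Z(π)`
  set R : ZXClass 1 1 := mk (X 1 1 (a + b)) ⨟ mk (Z 1 1 4) with hR
  have way1 : mk (dumbbell 0 0) ⊠ (mk (dumbbell 0 0) ⊠ (mk (X 1 1 a) ⨟ mk (X 1 1 b) ⨟ mk (Z 1 1 4) ⨟ R)) =
      mk (dumbbell 0 0) ⊠ (mk (dumbbell (a + b) 4) ⊠ mk (wires 1)) := by
    rw [xphase_seq_xphase, rule_K_seq, hR, K_remainder_inv]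
  have way2 : mk (dumbbell 0 0) ⊠ (mk (dumbbell 0 0) ⊠ (mk (X 1 1 a) ⨟ mk (X 1 1 b) ⨟ mk (Z 1 1 4) ⨟ R)) =
      mk (dumbbell b 4) ⊠ (mk (dumbbell a 4) ⊠ mk (wires 1)) := by
    rw [seq_assoc (mk (X 1 1 a)), seq_assoc (mk (X 1 1 a)), ← seq_scalar_par_one, rule_K_seq,
      seq_scalar_par_one, scalar_par_scalar_par, seq_assoc (mk (Z 1 1 4)) (mk (X 1 1 (-b))) R,
      ← seq_assoc (mk (X 1 1 a)) (mk (Z 1 1 4)), rule_K_seq, hR]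
    simp only [seq_assoc]
    rw [← seq_assoc (mk (X 1 1 (-b))) (mk (X 1 1 (a + b))) (mk (Z 1 1 4)), xphase_seq_xphase,
      ← seq_assoc (mk (X 1 1 (-a))), xphase_seq_xphase,
      show (-a + (-b + (a + b)) : ZMod 8) = 0 from by ring, X_one_one, id_seq, phase_seq_phase,
      show (4 : ZMod 8) + 4 = 0 from by decide, Z_one_one]
  have h := way1.symm.trans way2
  rw [par_assoc', cast_id, par_assoc', cast_id] at h
  exact cancel_wire h

/-- **JPV Lemma 6 (multiplying global phases)**: `(Z^{(0,1)}(π) ⨾ X^{(1,0)}(α)) ⊗ (Z^{(0,1)}(π) ⨾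
X^{(1,0)}(β)) = (Z^{(0,1)}(π) ⨾ X^{(1,0)}(α+β)) ⊗ (Z^{(0,1)}(0) ⨾ X^{(1,0)}(0))`.
[cite: JeandelPerdrixVilmart2018, Appendix Lemma 6] -/
theorem multiplying_global_phases (a b : ZMod 8) :
    (mk (Z 0 1 4) ⨟ mk (X 1 0 a)) ⊠ (mk (Z 0 1 4) ⨟ mk (X 1 0 b)) =
      (mk (Z 0 1 4) ⨟ mk (X 1 0 (a + b))) ⊠ (mk (Z 0 1 0) ⨟ mk (X 1 0 0)) := by
  rw [← dumbbell_symm, ← dumbbell_symm, ← dumbbell_symm, ← dumbbell_symm, scalar_par_comm,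
    ← sqrt_two_par_dumbbell_add, scalar_par_comm]

end ZXClass

end Literature.Computability.QuantumComplexity


/-! ## Part: `ZXCalculusPiBy2.lean` -/
/-!
# `ZX_{π/4}` modulo the calculus: Hadamard on states, Euler on states, the `-π/2` states

Topic `Literature/Computability/QuantumComplexity`, continuing `ZXCalculusScalars.lean` (layer A11 of
the formalisation of `JeandelPerdrixVilmart2018_completeness`): the first steps of
Backens–Perdrix–Wang's chain towards the π-copy rule (K1) (JPV Lemma 4), replayed with JPV's
axioms (their (EU') is JPV's (EU)).

* rule (H) on states and effects is exact: `Z^{(0,1)}(a) ⨾ H = X^{(0,1)}(a)` etc.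
  (`Z_state_seq_hBox`, `X_state_seq_hBox`, `hBox_seq_Z_effect`, `hBox_seq_X_effect`);
* hence, by (EU), every red state is a green Euler gadget:
  `X^{(0,1)}(a) = (Z^{(0,1)}(a+π/2) ⊗ Z^{(0,1)}(-π/2)) ⨾ X^{(2,1)} ⨾ Z^{(1,1)}(π/2)` (`X_state_eq_euler`);
* the two diagrams for `1/√2` agree (`invSqrtTwo_eq_red`, uniqueness of inverses);
* **the `-π/2` states** (1602.04744, Lemma `piby2transformation` and (piby2transcolour)):
  `X^{(0,1)}(-π/2) = (1/√2) ⊗ Z^{(0,0)}(-π/2) ⊗ Z^{(0,1)}(π/2)` (`X_state_neg_two`) and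
  `Z^{(0,1)}(-π/2) = (1/√2) ⊗ Z^{(0,0)}(-π/2) ⊗ X^{(0,1)}(π/2)` (`Z_state_neg_two`), by deleting the
  phase-free green state of the Euler gadget through the red merge (`sqrt_two_par_state_par_X_merge`);
* supplementarity at `-π/2` (`piby2_states_seq_X_merge`, rule (SUP)), the `±π/2` dots make `2`
  (`Z_dot_neg_two_par_Z_dot_two`), and **the `+π/2` states** (`Z_state_two`, `X_state_two`)
  (1602.04744 Lemma `piby2multip`, Cor. `piby2scalars`, Cor. `pibyb2swap`).

## References

* E. Jeandel, S. Perdrix, R. Vilmart, LICS 2018 (arXiv:1705.11151v2), Fig. 1 (EU), (H) and Appendix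
  Lemma 4 [JeandelPerdrixVilmart2018].
* M. Backens, S. Perdrix, Q. Wang, QPL 2016 (arXiv:1602.04744), App. A, Lemma `piby2transformation`
  and eq. (piby2transcolour) (the derivation followed here).
-/

noncomputable section

namespace Literature.Computability.QuantumComplexity

open ZXDiagram ZXClass

namespace ZXClass

/-! ### Rule (H) on states and effects -/

/-- A green state through a Hadamard box is the red state: `Z^{(0,1)}(a) ⨾ H = X^{(0,1)}(a)`. [cite: JeandelPerdrixVilmart2018, Fig. 1 (H)] -/
theorem Z_state_seq_hBox (a : ZMod 8) : mk (Z 0 1 a) ⨟ mk hBox = mk (X 0 1 a) := by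
  have h := rule_H' 0 1 a
  simp only [hTensor, mk_par, id_seq] at h
  rwa [empty_par, cast_id] at h

/-- A red state through a Hadamard box is the green state: `X^{(0,1)}(a) ⨾ H = Z^{(0,1)}(a)`. [cite: JeandelPerdrixVilmart2018, Fig. 1 (H)] -/
theorem X_state_seq_hBox (a : ZMod 8) : mk (X 0 1 a) ⨟ mk hBox = mk (Z 0 1 a) := by
  have h := rule_H 0 1 a
  simp only [hTensor, mk_par, id_seq] at h
  rwa [empty_par, cast_id] at h

/-- A Hadamard box before a green effect gives the red effect. [cite: JeandelPerdrixVilmart2018, Fig. 1 (H)] -/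
theorem hBox_seq_Z_effect (a : ZMod 8) : mk hBox ⨟ mk (Z 1 0 a) = mk (X 1 0 a) := by
  have h := congrArg transpose (Z_state_seq_hBox a)
  simpa using h

/-- A Hadamard box before a red effect gives the green effect. [cite: JeandelPerdrixVilmart2018, Fig. 1 (H)] -/
theorem hBox_seq_X_effect (a : ZMod 8) : mk hBox ⨟ mk (X 1 0 a) = mk (Z 1 0 a) := by
  have h := congrArg transpose (X_state_seq_hBox a)
  simpa using h

/-! ### Euler on states -/

/-- A green state absorbed by the first factor of a spatial composite. [folklore] -/
theorem Z_state_seq_phase_par (a b : ZMod 8) (B : ZXClass 0 1) :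
    mk (Z 0 1 a) ⨟ (mk (Z 1 1 b) ⊠ B) = mk (Z 0 1 (a + b)) ⊠ B := by
  rw [← par_empty (mk (Z 0 1 a)), interchange, id_seq, Z_seq_Z 0 1 1 le_rfl]

/-- **Every red state is a green Euler gadget** ((H) then (EU)):
`X^{(0,1)}(a) = (Z^{(0,1)}(a+π/2) ⊗ Z^{(0,1)}(-π/2)) ⨾ X^{(2,1)}(0) ⨾ Z^{(1,1)}(π/2)`. [cite: JeandelPerdrixVilmart2018, Fig. 1 (EU)] -/
theorem X_state_eq_euler (a : ZMod 8) :
    mk (X 0 1 a) = (mk (Z 0 1 (a + 2)) ⊠ mk (Z 0 1 (-2))) ⨟ mk (X 2 1 0) ⨟ mk (Z 1 1 2) := by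
  rw [← Z_state_seq_hBox, rule_EU, ← seq_assoc, ← seq_assoc, Z_state_seq_phase_par]

/-! ### The two diagrams for `1/√2` agree -/

/-- `Z^{(0,3)} ⨾ X^{(3,0)} = X^{(0,3)} ⨾ Z^{(3,0)}`: both are the inverse of `√2`. [cite: JeandelPerdrixVilmart2018, Appendix Lemma 5] -/
theorem invSqrtTwo_eq_red : mk invSqrtTwo = mk (X 0 3 0) ⨟ mk (Z 3 0 0) := by
  calc mk invSqrtTwo = mk invSqrtTwo ⊠ mk (wires 0) := (par_empty _).symm
    _ = mk invSqrtTwo ⊠ (mk (dumbbell 0 0) ⊠ (mk (X 0 3 0) ⨟ mk (Z 3 0 0))) := by rw [inverse_rule_red]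
    _ = mk (wires 0) ⊠ (mk (X 0 3 0) ⨟ mk (Z 3 0 0)) := by
        rw [par_assoc', cast_id, invSqrtTwo_par_dumbbell]
    _ = mk (X 0 3 0) ⨟ mk (Z 3 0 0) := by rw [empty_par, cast_id]

/-! ### Scalars next to states -/

/-- `𝕀⁰ ⊗ A = A` for states on one wire. [folklore] -/
theorem empty_par_state (A : ZXClass 0 1) : mk (wires 0) ⊠ A = A := by rw [empty_par, cast_id]

/-- A scalar next to a state is the scalar followed by the state. [folklore] -/
theorem scalar_par_state {m : ℕ} (s : ZXClass 0 0) (A : ZXClass 0 m) : s ⊠ A = s ⨟ (mk (wires 0) ⊠ A) := by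
  rw [par_eq_seq_left, par_empty]

/-- A state followed by a scalar-carrying map: the scalar may be taken out (arities `0 → 1 → 1`). [folklore] -/
theorem state_seq_scalar_par (s : ZXClass 0 0) (A : ZXClass 0 1) (B : ZXClass 1 1) :
    A ⨟ (s ⊠ B) = s ⊠ (A ⨟ B) := by
  rw [scalar_par_seq_right, empty_par, cast_id]

/-- A scalar-carrying state followed by a map (arities `0 → 1 → 1`). [folklore] -/
theorem scalar_par_state_seq (s : ZXClass 0 0) (A : ZXClass 0 1) (B : ZXClass 1 1) :
    (s ⊠ A) ⨟ B = s ⊠ (A ⨟ B) := by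
  rw [scalar_par_seq_left, empty_par, cast_id]

/-- A scalar-carrying state closed by an effect (arities `0 → 1 → 0`). [folklore] -/
theorem scalar_par_state_seq_effect (s : ZXClass 0 0) (A : ZXClass 0 1) (B : ZXClass 1 0) :
    (s ⊠ A) ⨟ B = s ⊠ (A ⨟ B) := by
  rw [scalar_par_seq_left, empty_par, cast_id]

/-! ### The `-π/2` states -/

/-- **The red `-π/2` state** (Backens–Perdrix–Wang, Lemma `piby2transformation`):
`X^{(0,1)}(-π/2) = (1/√2) ⊗ Z^{(0,0)}(-π/2) ⊗ Z^{(0,1)}(π/2)`. [cite: JeandelPerdrixVilmart2018, Appendix Lemma 4] -/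
theorem X_state_neg_two :
    mk (X 0 1 (-2)) = mk invSqrtTwo ⊠ (mk (Z 0 0 (-2)) ⊠ mk (Z 0 1 2)) := by
  have h1 : mk (X 0 1 (-2)) = mk (Z 0 1 (-2)) ⨟ ((mk (Z 0 1 0) ⊠ mk (wires 1)) ⨟ mk (X 2 1 0)) ⨟
      mk (Z 1 1 2) := by
    rw [X_state_eq_euler, show (-2 : ZMod 8) + 2 = 0 from by decide,
      par_eq_seq_right (mk (Z 0 1 0)) (mk (Z 0 1 (-2))), empty_par, cast_id, seq_assoc (mk (Z 0 1 (-2)))]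
  -- insert `1 = (1/√2) ⊗ √2` and delete the phase-free green state through the red merge
  have h2 : (mk (Z 0 1 0) ⊠ mk (wires 1)) ⨟ mk (X 2 1 0) =
      mk invSqrtTwo ⊠ (mk (Z 1 0 0) ⨟ mk (Z 0 1 0)) := by
    rw [← sqrt_two_par_state_par_X_merge, par_assoc', cast_id, invSqrtTwo_par_dumbbell, empty_par,
      cast_id]
  rw [h1, h2, state_seq_scalar_par, scalar_par_state_seq, ← seq_assoc, Z_seq_Z 0 1 0 le_rfl,
    seq_assoc, Z_seq_Z 0 1 1 le_rfl, add_zero (-2 : ZMod 8), zero_add (2 : ZMod 8),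
    scalar_par_state (mk (Z 0 0 (-2))) (mk (Z 0 1 2)), empty_par_state]

/-- **The green `-π/2` state** (Backens–Perdrix–Wang, eq. (piby2transcolour)):
`Z^{(0,1)}(-π/2) = (1/√2) ⊗ Z^{(0,0)}(-π/2) ⊗ X^{(0,1)}(π/2)`. [cite: JeandelPerdrixVilmart2018, Appendix Lemma 4] -/
theorem Z_state_neg_two :
    mk (Z 0 1 (-2)) = mk invSqrtTwo ⊠ (mk (Z 0 0 (-2)) ⊠ mk (X 0 1 2)) := by
  rw [← X_state_seq_hBox, X_state_neg_two, scalar_par_state_seq,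
    scalar_par_state (mk (Z 0 0 (-2))) (mk (Z 0 1 2)), empty_par_state, seq_assoc, Z_state_seq_hBox,
    scalar_par_state (mk (Z 0 0 (-2))) (mk (X 0 1 2)), empty_par_state]

/-! ### The `+π/2` states and the `±π/2` dots (1602.04744, Lemma `piby2multip`, Cor. `piby2scalars`,
Cor. `pibyb2swap`) -/

/-- A cup into a red merge is the red phase-free state: `η ⨾ X^{(2,1)} = X^{(0,1)}`. [folklore] -/
theorem cup_seq_X_merge : mk cup ⨟ mk (X 2 1 0) = mk (X 0 1 0) := by
  rw [← X_zero_two, X_seq_X 0 2 1 (by norm_num), add_zero]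

/-- **Supplementarity at `-π/2`**: `(Z^{(0,1)}(-π/2) ⊗ Z^{(0,1)}(π/2)) ⨾ X^{(2,1)} = X^{(0,1)}(0)`
(rule (SUP) at `α = -π/2`, then `η ⨾ X^{(2,1)} = X^{(0,1)}`). [cite: JeandelPerdrixVilmart2018, Fig. 1 (SUP)] -/
theorem piby2_states_seq_X_merge :
    (mk (Z 0 1 (-2)) ⊠ mk (Z 0 1 2)) ⨟ mk (X 2 1 0) = mk (X 0 1 0) := by
  have h := rule_SUP (-2)
  rw [show (-2 : ZMod 8) + 4 = 2 from by decide, show (2 : ZMod 8) * -2 + 4 = 0 from by decide,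
    Z_zero_two, cup_seq_X_merge] at h
  exact h

/-- A green dot un-fused: `Z^{(0,0)}(c) = Z^{(0,1)}(c) ⨾ Z^{(1,0)}(0)`. [cite: JeandelPerdrixVilmart2018, Fig. 1 (S1)] -/
theorem Z_dot_eq (c : ZMod 8) : mk (Z 0 0 c) = mk (Z 0 1 c) ⨟ mk (Z 1 0 0) := by
  rw [Z_seq_Z 0 1 0 le_rfl, add_zero]

/-- **The two `±π/2` green dots make `2`**: `Z^{(0,0)}(-π/2) ⊗ Z^{(0,0)}(π/2) = √2 ⊗ √2`
(un-fuse, (B1), supplementarity at `-π/2`). [cite: JeandelPerdrixVilmart2018, Appendix Lemma 4] -/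
theorem Z_dot_neg_two_par_Z_dot_two :
    mk (Z 0 0 (-2)) ⊠ mk (Z 0 0 2) = mk (dumbbell 0 0) ⊠ mk (dumbbell 0 0) := by
  rw [Z_dot_eq (-2), Z_dot_eq 2, ← interchange, ← rule_B1_effect,
    show (mk (Z 0 1 (-2)) ⊠ mk (Z 0 1 2)) ⨟ (mk (dumbbell 0 0) ⊠ (mk (X 2 1 0) ⨟ mk (Z 1 0 0))) =
      mk (dumbbell 0 0) ⊠ ((mk (Z 0 1 (-2)) ⊠ mk (Z 0 1 2)) ⨟ (mk (X 2 1 0) ⨟ mk (Z 1 0 0))) from by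
        rw [scalar_par_seq_right (mk (dumbbell 0 0)) (mk (Z 0 1 (-2)) ⊠ mk (Z 0 1 2)), empty_par,
          cast_id],
    ← seq_assoc, piby2_states_seq_X_merge]
  rfl

/-- **The green `+π/2` state** (Backens–Perdrix–Wang, eq. (piby2gntored)):
`Z^{(0,1)}(π/2) = (1/√2) ⊗ Z^{(0,0)}(π/2) ⊗ X^{(0,1)}(-π/2)`. [cite: JeandelPerdrixVilmart2018, Appendix Lemma 4] -/
theorem Z_state_two : mk (Z 0 1 2) = mk invSqrtTwo ⊠ (mk (Z 0 0 2) ⊠ mk (X 0 1 (-2))) := by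
  have h : mk (Z 0 0 2) ⊠ mk (X 0 1 (-2)) = mk (dumbbell 0 0) ⊠ mk (Z 0 1 2) := by
    rw [X_state_neg_two, scalar_par_scalar_par (mk (Z 0 0 2)) (mk invSqrtTwo),
      show mk (Z 0 0 2) ⊠ (mk (Z 0 0 (-2)) ⊠ mk (Z 0 1 2)) = (mk (Z 0 0 (-2)) ⊠ mk (Z 0 0 2)) ⊠ mk (Z 0 1 2)
        from by rw [scalar_par_scalar_par]; exact (par_assoc' _ _ _).trans (cast_id _ _ _),
      Z_dot_neg_two_par_Z_dot_two, show (mk (dumbbell 0 0) ⊠ mk (dumbbell 0 0)) ⊠ mk (Z 0 1 2) =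
        mk (dumbbell 0 0) ⊠ (mk (dumbbell 0 0) ⊠ mk (Z 0 1 2)) from (par_assoc _ _ _).trans (cast_id _ _ _),
      par_assoc', cast_id, invSqrtTwo_par_dumbbell, empty_par_state]
  rw [h, par_assoc', cast_id, invSqrtTwo_par_dumbbell, empty_par_state]

/-- **The red `+π/2` state**: `X^{(0,1)}(π/2) = (1/√2) ⊗ Z^{(0,0)}(π/2) ⊗ Z^{(0,1)}(-π/2)`.
[cite: JeandelPerdrixVilmart2018, Appendix Lemma 4] -/
theorem X_state_two : mk (X 0 1 2) = mk invSqrtTwo ⊠ (mk (Z 0 0 2) ⊠ mk (Z 0 1 (-2))) := by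
  rw [← Z_state_seq_hBox, Z_state_two, scalar_par_state_seq,
    scalar_par_state (mk (Z 0 0 2)) (mk (X 0 1 (-2))), empty_par_state, seq_assoc, X_state_seq_hBox,
    scalar_par_state (mk (Z 0 0 2)) (mk (Z 0 1 (-2))), empty_par_state]

end ZXClass

end Literature.Computability.QuantumComplexity


/-! ## Part: `ZXCalculusAngleDelete.lean` -/
/-!
# `ZX_{π/4}` modulo the calculus: deleting Clifford angles on the scalar `√2`

Topic `Literature/Computability/QuantumComplexity`, continuing `ZXCalculusPiBy2.lean` (layer A12 of
the formalisation of `JeandelPerdrixVilmart2018_completeness`): Backens–Perdrix–Wang's Lemma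
`lem:innerprod` ("angle delete") — JPV's Lemma 7 at the Clifford angles — for JPV's scalars
`dumbbell 0 k = X^{(0,1)}(0) ⨾ Z^{(1,0)}(k)` (the colour swap / flip of `Z^{(0,1)}(k) ⨾ X^{(1,0)}(0)`).

* the legless red dot is the legless green dot (`X_dot_eq_Z_dot`, rule (H) at arity `0 → 0`);
* (B1) closed by two green effects: `√2 ⊗ dumbbell 0 (b+c) = dumbbell 0 b ⊗ dumbbell 0 c`
  (`sqrt_two_par_dumbbell_zero_add`);
* **angle delete** at `-π/2`, `π/2` (from the `∓π/2` state lemmas and `Z^{(0,0)}(-π/2) ⊗ Z^{(0,0)}(π/2)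
  = 2`) and at `π` (from Lemma 6 at `a = b = 0` against (B1) at `b = c = π`, cancelling `√2`):
  `dumbbell 0 k = √2` for `k ∈ {2, -2, 4}` (`dumbbell_zero_two`, `dumbbell_zero_neg_two`,
  `dumbbell_zero_four`), hence `4`-periodicity in the green phase (`dumbbell_zero_add_four`) and the
  state/effect forms `Z^{(0,1)}(k) ⨾ X^{(1,0)}(0) = √2'` (`Z_state_seq_X_effect_eq`).

## References

* E. Jeandel, S. Perdrix, R. Vilmart, LICS 2018 (arXiv:1705.11151v2), Appendix Lemma 7 and rules
  (B1), (K), (H) [JeandelPerdrixVilmart2018].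
* M. Backens, S. Perdrix, Q. Wang, QPL 2016 (arXiv:1602.04744), App. A, Lemma `lem:innerprod`.
-/

noncomputable section

namespace Literature.Computability.QuantumComplexity

open ZXDiagram ZXClass

namespace ZXClass

/-- The legless red dot is the legless green dot: `X^{(0,0)}(a) = Z^{(0,0)}(a)` (rule (H) with no
Hadamard boxes at all). [cite: JeandelPerdrixVilmart2018, Fig. 1 (H)] -/
theorem X_dot_eq_Z_dot (a : ZMod 8) : mk (X 0 0 a) = mk (Z 0 0 a) := by
  have h := rule_H 0 0 a
  simpa [hTensor] using h

/-- A green effect with phase `b + c` un-fused into a split and two effects. [cite: JeandelPerdrixVilmart2018, Fig. 1 (S1)] -/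
theorem Z_effect_add_eq (b c : ZMod 8) :
    mk (Z 1 0 (b + c)) = mk (Z 1 2 0) ⨟ (mk (Z 1 0 b) ⊠ mk (Z 1 0 c)) := by
  rw [par_eq_seq_left (mk (Z 1 0 b)) (mk (Z 1 0 c)), empty_par, cast_id, ← seq_assoc,
    Z_seq_Z_par 1 1 1 0 le_rfl, add_zero b, Z_seq_Z 1 1 0 le_rfl]

/-- **(B1) closed by two green effects**: `√2 ⊗ dumbbell 0 (b+c) = dumbbell 0 b ⊗ dumbbell 0 c`.
[cite: JeandelPerdrixVilmart2018, Fig. 1 (B1)] -/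
theorem sqrt_two_par_dumbbell_zero_add (b c : ZMod 8) :
    mk (dumbbell 0 0) ⊠ mk (dumbbell 0 (b + c)) = mk (dumbbell 0 b) ⊠ mk (dumbbell 0 c) := by
  conv_lhs => arg 2; rw [dumbbell, mk_seq, Z_effect_add_eq, ← seq_assoc]
  rw [scalar_par_seq_left, rule_B1, empty_par, cast_id, interchange]
  rfl

/-- **Angle delete at `-π/2`**: `dumbbell 0 (-2) = √2`. [cite: JeandelPerdrixVilmart2018, Appendix Lemma 7] -/
theorem dumbbell_zero_neg_two : mk (dumbbell 0 (-2)) = mk (dumbbell 0 0) := by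
  rw [dumbbell_symm, Z_state_neg_two, scalar_par_state_seq_effect, scalar_par_state_seq_effect,
    X_seq_X 0 1 0 le_rfl, add_zero (2 : ZMod 8), X_dot_eq_Z_dot, Z_dot_neg_two_par_Z_dot_two, par_assoc',
    cast_id, invSqrtTwo_par_dumbbell, empty_par, cast_id]

/-- **Angle delete at `π/2`**: `dumbbell 0 2 = √2`. [cite: JeandelPerdrixVilmart2018, Appendix Lemma 7] -/
theorem dumbbell_zero_two : mk (dumbbell 0 2) = mk (dumbbell 0 0) := by
  rw [dumbbell_symm, Z_state_two, scalar_par_state_seq_effect, scalar_par_state_seq_effect,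
    X_seq_X 0 1 0 le_rfl, add_zero (-2 : ZMod 8), X_dot_eq_Z_dot, scalar_par_comm (mk (Z 0 0 2)),
    Z_dot_neg_two_par_Z_dot_two, par_assoc', cast_id, invSqrtTwo_par_dumbbell, empty_par, cast_id]

/-- **Angle delete at `π`**: `dumbbell 0 π = √2` (Lemma 6 at `a = b = 0` against (B1) at `b = c = π`).
[cite: JeandelPerdrixVilmart2018, Appendix Lemma 7] -/
theorem dumbbell_zero_four : mk (dumbbell 0 4) = mk (dumbbell 0 0) := by
  have hK := sqrt_two_par_dumbbell_add 0 0       -- √2 ⊗ db (0+0) 4 = db 0 4 ⊗ db 0 4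
  have hB := sqrt_two_par_dumbbell_zero_add 4 4  -- √2 ⊗ db 0 (4+4) = db 0 4 ⊗ db 0 4
  rw [add_zero (0 : ZMod 8)] at hK
  rw [show (4 : ZMod 8) + 4 = 0 from by decide] at hB
  exact cancel_sqrt_two (((scalar_par_comm _ _).trans (hK.trans hB.symm)).trans (scalar_par_comm _ _))

/-- The green phase of `dumbbell 0 k` only matters modulo `π`. [cite: JeandelPerdrixVilmart2018, Appendix Lemma 7] -/
theorem dumbbell_zero_add_four (b : ZMod 8) : mk (dumbbell 0 (b + 4)) = mk (dumbbell 0 b) := by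
  have h := sqrt_two_par_dumbbell_zero_add b 4
  rw [dumbbell_zero_four, scalar_par_comm] at h
  exact cancel_sqrt_two h

/-- **Angle delete, state/effect form** (JPV Lemma 7 at the Clifford angles `k ∈ {0, ±π/2, π}`):
`Z^{(0,1)}(k) ⨾ X^{(1,0)}(0) = Z^{(0,1)}(0) ⨾ X^{(1,0)}(0)`. [cite: JeandelPerdrixVilmart2018, Appendix Lemma 7] -/
theorem Z_state_seq_X_effect_eq {k : ZMod 8} (hk : k = 2 ∨ k = -2 ∨ k = 4) :
    mk (Z 0 1 k) ⨟ mk (X 1 0 0) = mk (Z 0 1 0) ⨟ mk (X 1 0 0) := by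
  rw [← dumbbell_symm, ← dumbbell_symm]
  rcases hk with rfl | rfl | rfl
  · exact dumbbell_zero_two
  · exact dumbbell_zero_neg_two
  · exact dumbbell_zero_four

end ZXClass

end Literature.Computability.QuantumComplexity
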